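import Summits.Ventures.YMGap.Thresholds.TwistedBochnerSU3
import Summits.Ventures.YMGap.Thresholds.OneLinkVarianceSDCentred
import Summits.Ventures.YMGap.Thresholds.StarMassGapSUN
import HarnessLib

/-!
# Venture YMGap — the `SU(3)` one-link modulus on the TWISTED Poincaré constant: `K_PV2T(R) = √(v_PV2(3,R)/K₃(R))`, hypothesis-free;
# `SU(3)` instances at the cell's radii and `ImprovedThreshold 4 3 (9/200)`

HONEST FRAMING.  Venture file of the cell `pub-ymgap` (QuantumFields programme), seat engine-2 (g11); 0 compute.  Explicit STRONG-COUPLING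
constants for lattice `SU(3)` Yang–Mills (small `β`); NOT weak coupling, NOT a continuum statement, NOT a Yang–Mills mass-gap claim.

WHAT.  pub-balaban's door `oneLinkKRModulus_of_poincare_of_varianceBound` (`K = √(c·v)`) fed with
* `c = 1/K_p`, `0 < K_p`, `K_p + (97/50)R ≤ 12/7` — the TWISTED one-link Poincaré constant of `TwistedBochnerSU3.oneLinkPoincareSUN_su3_twisted`
  (Bakry–Émery: `1/(3(1/2 − R))`, `R < 1/2` only), and
* `v = K_p·K²` with `48τ(τ−1) + 27τ³R² ≤ 16(τ−1)·K_p·K²` — engine-2 g10's CENTRED Schwinger–Dyson variance `su3_oneLinkVarianceBound_sdc_of_le`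
  (`v_PV2(3,R;τ) = 3(τ + 9τ³R²/(16(τ−1)))`),
gives `su3_oneLinkKRModulus_pv2t_of_le : OneLinkKRModulus 3 R K` (one `norm_num` per instance), `su3_sqrt_cP_twisted_le` (`√(1/K_p) ≤ S_q` when
`K_p S_q² ≥ 1`) and the packaged robust-door inputs `su3_pv2t_star_inputs` (consumed by the `RobustBall/*PV2T*` row files).  `SU(3)` INSTANCES (exact-rational certificates
`HOME/pub-ymgap-engine-2/pv2t/cert_pv2t.json`; in brackets g10's `K_PV2` on Bakry–Émery): `R = 1/5`: `3531/2000 = 1.7655` (`2.1432`); `1/4`: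
`19139/10000` (`2.4502`); `3/10`: `20827/10000` (`2.8610`); `11/30`: `4693/2000 = 2.3465` (`3.7156`; the CERTIFIED constant GIVEN H1 ∧ H2 is `7/5`);
`2/5`: `12493/5000` (`4.4187`); `1/2`: `7661/2500 = 3.0644` (Bakry–Émery: none); `3/5`: `19441/5000 = 3.888` (none).  TRACK (a): ds-1's star door
`4K|x| ≤ 9/25` at `R = 27/100`, `K = 4947/2500` gives `massGapAt_su3_pv2t (|x| ≤ 9/200)` and ★ `improvedThreshold_su3_pv2t : ImprovedThreshold 4 3 (9/200)`
(`x₀ = 0.045`, Wilson `β_W < 0.405`; was `29/750`, `β_W < 0.348`, `StarSU3PV2DimRows`; printed Shen–Zhu–Zhu `1/48`).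
NOT CLAIMED: anything for `SU(2)` or `N ≥ 4`; the certified column; sharpness.

References: Shen–Zhu–Zhu CMP 400 (2023) Thm. 1.2, Cor. 1.6, Lemma 4.1; H. Föllmer LNM 1362 (1988) Thm. (2.13); the tree:
`Thresholds/TwistedBochnerSU3.lean` (engine-2 g11), `Thresholds/OneLinkVarianceSDCentred.lean` (engine-2 g10), `Thresholds/StarMassGapSUN.lean` (ds-1).
-/

noncomputable section

open Literature.MathematicalPhysics.QuantumFieldTheory
open Literature.MathematicalPhysics.QuantumFieldTheory.Balaban1983to89.StrongCouplingDobrushinWindow (OneLinkKRModulus)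
open Summit.QuantumFields.BalabanUV.InfraRed.StrongCouplingVarianceDoorSUN (OneLinkVarianceBound)
open Summit.QuantumFields.BalabanUV.InfraRed.StrongCouplingPoincareDoorSUN (OneLinkPoincareSUN oneLinkKRModulus_of_poincare_of_varianceBound)
open Summit.Ventures.YMGap.OneLinkVarianceSDC (su3_oneLinkVarianceBound_sdc_of_le)
open Summit.Ventures.YMGap.StarSUNLimit (star_massGapAt_of_oneLinkKRModulus)

namespace Summit.Ventures.YMGap.TwistedBochner

/-! ### 1. The modulus on the twisted constant -/

/-- Off-column input: `√(1/K_p) ≤ S_q` whenever `0 < K_p`, `0 ≤ S_q`, `1 ≤ K_p S_q²`. [folklore] -/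
theorem su3_sqrt_cP_twisted_le {Kp Sq : ℝ} (hKp : 0 < Kp) (hSq0 : 0 ≤ Sq) (hSq : 1 ≤ Kp * Sq ^ 2) :
    Real.sqrt (1 / Kp) ≤ Sq := by
  rw [← Real.sqrt_sq hSq0]
  apply Real.sqrt_le_sqrt
  rw [div_le_iff₀ hKp]
  linarith

/-- **`SU(3)` twisted inputs**: the Poincaré constant `1/K_p` (`0 < K_p`, `K_p + (97/50)R ≤ 12/7`) and the centred Schwinger–Dyson variance in the
enveloped form `v = K_p K²` (`48τ(τ−1) + 27τ³R² ≤ 16(τ−1)K_pK²`), so that `√(c·v) = K`. [folklore] -/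
theorem su3_twisted_pair {R τ K Kp : ℝ} (hτ : 1 < τ) (hKp : 0 < Kp) (hKpR : Kp + 97 / 50 * R ≤ 12 / 7) (hK0 : 0 ≤ K)
    (hK : 48 * τ * (τ - 1) + 27 * τ ^ 3 * R ^ 2 ≤ 16 * (τ - 1) * (Kp * K ^ 2)) :
    OneLinkPoincareSUN 3 R (1 / Kp) ∧ OneLinkVarianceBound 3 R (Kp * K ^ 2) ∧ Real.sqrt (1 / Kp * (Kp * K ^ 2)) = K := by
  refine ⟨oneLinkPoincareSUN_su3_twisted hKp hKpR, su3_oneLinkVarianceBound_sdc_of_le hτ hK, ?_⟩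
  have e : 1 / Kp * (Kp * K ^ 2) = K ^ 2 := by field_simp
  rw [e, Real.sqrt_sq hK0]

/-- **THE `SU(3)` MODULUS ON THE TWISTED CONSTANT, HYPOTHESIS-FREE**: for `τ > 1`, `0 < K_p`, `K_p + (97/50)R ≤ 12/7`, `K ≥ 0` with
`48τ(τ−1) + 27τ³R² ≤ 16(τ−1)·K_p·K²`:  `OneLinkKRModulus 3 R K`  (`K ≥ K_PV2T(R;τ) = √(3(τ + 9τ³R²/(16(τ−1)))/K_p)`). [folklore] -/
theorem su3_oneLinkKRModulus_pv2t_of_le {R τ K Kp : ℝ} (hτ : 1 < τ) (hKp : 0 < Kp) (hKpR : Kp + 97 / 50 * R ≤ 12 / 7) (hK0 : 0 ≤ K)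
    (hK : 48 * τ * (τ - 1) + 27 * τ ^ 3 * R ^ 2 ≤ 16 * (τ - 1) * (Kp * K ^ 2)) : OneLinkKRModulus 3 R K := by
  obtain ⟨hP, hV, e⟩ := su3_twisted_pair hτ hKp hKpR hK0 hK
  have h := oneLinkKRModulus_of_poincare_of_varianceBound (by positivity) (by positivity) hP hV
  rw [e] at h
  exact h

/-- **The PV2T door inputs for `SU(3)`** (consumed by the robust-star row files): with `τ > 1`, `0 < K_p`, `K_p + (97/50)R ≤ 12/7`, rational
majorants `K_s ≥ 0`, `48τ(τ−1) + 27τ³R² ≤ 16(τ−1)K_pK_s²`, `S_q ≥ 0`, `K_p S_q² ≥ 1`, `e^{ε₀} ≤ E`, `e^{ε₀/2} ≤ E₂`: the twisted Poincaré constant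
`c_P = 1/K_p`, the centred Schwinger–Dyson variance bound `v = K_p K_s²`, and the two enveloped door inputs `e^{ε₀}√(c_P v)·x ≤ E K_s x`,
`e^{ε₀/2}√c_P·ε₁ ≤ E₂ S_q ε₁`. [folklore] -/
theorem su3_pv2t_star_inputs {R ε₀ ε₁ E E₂ τ Ks Sq Kp x : ℝ} (hτ : 1 < τ) (hKp : 0 < Kp) (hKpR : Kp + 97 / 50 * R ≤ 12 / 7)
    (hε₁ : 0 ≤ ε₁) (hx : 0 ≤ x) (hE : Real.exp ε₀ ≤ E) (hE₂ : Real.exp (ε₀ / 2) ≤ E₂) (hKs0 : 0 ≤ Ks)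
    (hKs : 48 * τ * (τ - 1) + 27 * τ ^ 3 * R ^ 2 ≤ 16 * (τ - 1) * (Kp * Ks ^ 2)) (hSq0 : 0 ≤ Sq) (hSq : 1 ≤ Kp * Sq ^ 2) :
    OneLinkPoincareSUN 3 R (1 / Kp) ∧ OneLinkVarianceBound 3 R (Kp * Ks ^ 2) ∧
      Real.exp ε₀ * Real.sqrt (1 / Kp * (Kp * Ks ^ 2)) * x ≤ E * Ks * x ∧
      Real.exp (ε₀ / 2) * Real.sqrt (1 / Kp) * ε₁ ≤ E₂ * Sq * ε₁ := by
  have hE0 : 0 ≤ E := (Real.exp_pos _).le.trans hE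
  have hE20 : 0 ≤ E₂ := (Real.exp_pos _).le.trans hE₂
  obtain ⟨hP, hV, hKs'⟩ := su3_twisted_pair hτ hKp hKpR hKs0 hKs
  refine ⟨hP, hV, ?_, ?_⟩
  · rw [hKs']
    exact mul_le_mul_of_nonneg_right (mul_le_mul_of_nonneg_right hE hKs0) hx
  · exact mul_le_mul_of_nonneg_right (mul_le_mul hE₂ (su3_sqrt_cP_twisted_le hKp hSq0 hSq) (Real.sqrt_nonneg _) hE20) hε₁

/-! ### 2. `SU(3)` instances (one `norm_num` each; in brackets the Bakry–Émery-based `K_PV2` of g10) -/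

/-- `R = 1/5` (`β_W = 3/10` at the `d = 4` radius `2β_W/3`): `OneLinkKRModulus 3 (1/5) (3531/2000)` (`1.7655`; `K_PV2 = 2.1432`, Bakry–Émery alone
`10/3`). [folklore] -/
theorem su3_oneLinkKRModulus_pv2t_oneFifth : OneLinkKRModulus 3 (1 / 5) (3531 / 2000) :=
  su3_oneLinkKRModulus_pv2t_of_le (τ := 143 / 125) (Kp := 2321 / 1750) (by norm_num) (by norm_num) (by norm_num) (by norm_num) (by norm_num)

/-- `R = 1/4` (`β_W = 3/8`): `OneLinkKRModulus 3 (1/4) (19139/10000)` (`K_PV2 = 2.4502`). [folklore] -/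
theorem su3_oneLinkKRModulus_pv2t_oneQuarter : OneLinkKRModulus 3 (1 / 4) (19139 / 10000) :=
  su3_oneLinkKRModulus_pv2t_of_le (τ := 589 / 500) (Kp := 1721 / 1400) (by norm_num) (by norm_num) (by norm_num) (by norm_num) (by norm_num)

/-- `R = 3/10` (`β_W = 9/20`): `OneLinkKRModulus 3 (3/10) (20827/10000)` (`K_PV2 = 2.8610`). [folklore] -/
theorem su3_oneLinkKRModulus_pv2t_threeTenths : OneLinkKRModulus 3 (3 / 10) (20827 / 10000) :=
  su3_oneLinkKRModulus_pv2t_of_le (τ := 151 / 125) (Kp := 3963 / 3500) (by norm_num) (by norm_num) (by norm_num) (by norm_num) (by norm_num)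

/-- `R = 11/30` (the cell's star radius, `β_W = 11/20`): `OneLinkKRModulus 3 (11/30) (4693/2000)` (`2.3465`; `K_PV2 = 3.7156`; the CERTIFIED
constant given H1 ∧ H2 is `7/5`). [folklore] -/
theorem su3_oneLinkKRModulus_pv2t_elevenThirtieths : OneLinkKRModulus 3 (11 / 30) (4693 / 2000) :=
  su3_oneLinkKRModulus_pv2t_of_le (τ := 311 / 250) (Kp := 10531 / 10500) (by norm_num) (by norm_num) (by norm_num) (by norm_num)
    (by norm_num)

/-- `R = 2/5` (`β_W = 3/5`): `OneLinkKRModulus 3 (2/5) (12493/5000)` (`2.4986`; `K_PV2 = 4.4187`). [folklore] -/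
theorem su3_oneLinkKRModulus_pv2t_twoFifths : OneLinkKRModulus 3 (2 / 5) (12493 / 5000) :=
  su3_oneLinkKRModulus_pv2t_of_le (τ := 631 / 500) (Kp := 821 / 875) (by norm_num) (by norm_num) (by norm_num) (by norm_num) (by norm_num)

/-- `R = 1/2` (`β_W = 3/4`; Bakry–Émery's cap — no hypothesis-free modulus before): `OneLinkKRModulus 3 (1/2) (7661/2500)` (`3.0644`). [folklore] -/
theorem su3_oneLinkKRModulus_pv2t_oneHalf : OneLinkKRModulus 3 (1 / 2) (7661 / 2500) :=
  su3_oneLinkKRModulus_pv2t_of_le (τ := 163 / 125) (Kp := 521 / 700) (by norm_num) (by norm_num) (by norm_num) (by norm_num) (by norm_num)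

/-- `R = 3/5` (the cell's area-law radius, `β_W = 9/10`): `OneLinkKRModulus 3 (3/5) (19441/5000)` (`3.888`; the CERTIFIED pair at this radius reads
`√((4/5)(17/5)) = 1.65`). [folklore] -/
theorem su3_oneLinkKRModulus_pv2t_threeFifths : OneLinkKRModulus 3 (3 / 5) (19441 / 5000) :=
  su3_oneLinkKRModulus_pv2t_of_le (τ := 67 / 50) (Kp := 963 / 1750) (by norm_num) (by norm_num) (by norm_num) (by norm_num) (by norm_num)

/-- `R = 27/100` (the track-(a) radius `6 · (9/200)`): `OneLinkKRModulus 3 (27/100) (4947/2500)` (`1.9788`). [folklore] -/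
theorem su3_oneLinkKRModulus_pv2t_r27 : OneLinkKRModulus 3 (27 / 100) (4947 / 2500) :=
  su3_oneLinkKRModulus_pv2t_of_le (τ := 119 / 100) (Kp := 41667 / 35000) (by norm_num) (by norm_num) (by norm_num) (by norm_num)
    (by norm_num)

/-! ### 3. Track (a): `ImprovedThreshold 4 3 (9/200)` -/

/-- **`SU(3)`, `d = 4`, HYPOTHESIS-FREE: `MassGapAt 4 3 x` for every 't Hooft `|x| ≤ 9/200`** (Wilson `|β_W| ≤ 81/200 = 0.405`): ds-1's star door
`4K|x| ≤ 9/25` with the twisted modulus `K = 4947/2500` at radius `27/100 ≥ 6|x|` (`4 · 1.9788 · 0.045 = 0.3562`). [folklore] -/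
theorem massGapAt_su3_pv2t {x : ℝ} (h : |x| ≤ 9 / 200) : MassGapAt 4 3 x := by
  have hx0 : 0 ≤ |x| := abs_nonneg x
  refine star_massGapAt_of_oneLinkKRModulus (N := 3) (by norm_num) (K := 4947 / 2500) (R := 27 / 100) (by norm_num)
    (by linarith) su3_oneLinkKRModulus_pv2t_r27 ?_
  nlinarith

/-- ★ **`ImprovedThreshold 4 3 (9/200)` — `SU(3)`, `d = 4`, HYPOTHESIS-FREE** (`x₀ = 0.045`, Wilson `β_W < 0.405`; was `29/750` (`β_W < 0.348`,
Bakry–Émery-based PV2); `× 2.16` over Shen–Zhu–Zhu's printed `1/48`). [folklore] -/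
theorem improvedThreshold_su3_pv2t : ImprovedThreshold 4 3 (9 / 200) :=
  ⟨by norm_num, fun _ hx => massGapAt_su3_pv2t hx.le⟩

end Summit.Ventures.YMGap.TwistedBochner

end
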